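import Summits.CriticalPhenomena.PercolationContinuityZ3.Theorems.Transplant.PlanarSkeletonFrmFromDefs
import Summits.CriticalPhenomena.PercolationContinuityZ3.Theorems.Transplant.SkelPhiCorridorKGYValues
import Summits.CriticalPhenomena.PercolationContinuityZ3.Theorems.Transplant.SkelFrmFromBParamsCorrKG
import Summits.CriticalPhenomena.PercolationContinuityZ3.Theorems.Transplant.SkelFrmBParamsCorrKG
import HarnessLib
import Summits.CriticalPhenomena.PercolationContinuityZ3.Theorems.Transplant.SkelFrmBParamsCorrKGY
/-!
# U-WAVE PORT (RULING D-U, lead g21 2026-08-26; WAVE-U-MANIFEST v3.1 row «SkelFrmBParamsCorrKGY» ↦ «SkelFrmFromBParamsCorrKGY») of the tree module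
# `Transplant/SkelFrmBParamsCorrKGY` onto the carrier `PlanarSkeletonFrmFrom` (frames only, cylinders connected from width `ℓ₀` on)

ORIGINAL TITLE: N2 (frames-only node `SamePDropOfSkeletonFrmFrom₁`, OPEN) — (ζ″) ledger, THE K-G CORRIDOR SLOT VALUES INSTANTIATED, SECOND AXIS (N-corridor):

builds on p205010 (kernel theorem, internal audit signed; external expert review pending) — nothing in this file uses p205010; NOTHING is claimed about the
OPEN node U `SamePDropOfSkeletonFrmFrom₁` (nor U_s / the end state).  Lane `prim-bschramm`, seat `prim-bschramm-stmt` gen 26 (port pen, RULING M-11 family P-stmt; tool = p3-g26's port_u.py of record, registry-driven inputs); helper file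
(`--supports stmt-CriticalPhenomena-4575 --as helper`).  PORT RULES r1–r4 of RULING D-U: declaration order and proof texts are those of the original,
byte-identical except (i) the carrier token `PlanarSkeletonFrm ↦ PlanarSkeletonFrmFrom` (binders, `namespace`/`end` lines, qualified names of twinned
declarations), (ii) carrier-FREE declarations of the original (φ-level `Skelφ…` blocks and namespace-only arithmetic residents) are NOT re-declared —
this file imports the original and `export`s the twin-free residents (POLICY T / treatment (m1)); residents whose statement mentions a twinned
constant are copied, (iii) every carrier-binding declaration keeps its explicit binder `(Φ : PlanarSkeletonFrmFrom G)` in its own signature (r2).  Docstrings and citations are the original's.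
-/

open scoped Classical

noncomputable section

namespace Summit.CriticalPhenomena.PercolationContinuityZ3.Theorems.Transplant

namespace PlanarSkeletonFrmFrom

namespace NegB

open Literature.Probability.Percolation Literature.Probability.LatticeModels SimpleGraph
open SkelConc (Consts)
open Skelφ (shearUnit kgSL kgSLY kgΔY kgNY kgFarY KGYRows)
open Neg

/-! ## §1 The inputs of record, second axis -/

section InputsY

variable (κ : Consts) {V : Type} [DecidableEq V] [Countable V] {G : SimpleGraph V} [G.LocallyFinite] (Φ : PlanarSkeletonFrmFrom G) (t : V) (p : unitInterval)
  (D : Skelφ.StepI.DataNS V) (g f mk qx Wx : ℕ)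

/-- **The across start-extent slot** `q := P + qx`, `P := ⌊n_Lℓ_L/U⌋ + 1`. [this work] -/
def kgqY (κ : Consts) {V : Type} [DecidableEq V] [Countable V] {G : SimpleGraph V} [G.LocallyFinite] (Φ : PlanarSkeletonFrmFrom G) (t : V) (p : unitInterval) (D : Skelφ.StepI.DataNS V) (g : ℕ) (f : ℕ) (qx : ℕ) : ℕ := nL κ Φ t p D g f * ℓL κ Φ t p D g f / shearUnit (nL κ Φ t p D g f) (hL κ Φ t p D g f) + 1 + qx

/-- **The phase-2 window slot** `W := 2·n_L + Wx`. [this work] -/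
def kgWY (κ : Consts) {V : Type} [DecidableEq V] [Countable V] {G : SimpleGraph V} [G.LocallyFinite] (Φ : PlanarSkeletonFrmFrom G) (t : V) (p : unitInterval) (D : Skelφ.StepI.DataNS V) (g : ℕ) (f : ℕ) (Wx : ℕ) : ℕ := 2 * nL κ Φ t p D g f + Wx

/-- **The cell pitch along y′ in ROWS**: `(20·K·m)/U`, `m := n_L·v_β − h_L·v_L`. [cite: KozmaNitzan2024, §4 p. 26 (29)] -/
def pitchY (κ : Consts) {V : Type} [DecidableEq V] [Countable V] {G : SimpleGraph V} [G.LocallyFinite] (Φ : PlanarSkeletonFrmFrom G) (t : V) (p : unitInterval) (D : Skelφ.StepI.DataNS V) (g : ℕ) (f : ℕ) : ℤ :=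
  (20 * (Neg.K κ : ℤ) * TwoAxis.Para.modulus (nL κ Φ t p D g f) (hL κ Φ t p D g f) (vL κ Φ t p D g f) (vβL κ Φ t p D g f)) /
    (shearUnit (nL κ Φ t p D g f) (hL κ Φ t p D g f) : ℕ)

/-- **The steering target (rows)** `tgt := pitchY + (P + ρ − 1)/2 + (sL + ΔY)/2`. [this work] -/
def kgTgtY (κ : Consts) {V : Type} [DecidableEq V] [Countable V] {G : SimpleGraph V} [G.LocallyFinite] (Φ : PlanarSkeletonFrmFrom G) (t : V) (p : unitInterval) (D : Skelφ.StepI.DataNS V) (g : ℕ) (f : ℕ) (mk : ℕ) : ℤ :=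
  pitchY κ Φ t p D g f + ((((nL κ Φ t p D g f * ℓL κ Φ t p D g f / shearUnit (nL κ Φ t p D g f) (hL κ Φ t p D g f) + 1 : ℕ) : ℤ) + kgρ D - 1) / 2) +
    (kgSLY (nL κ Φ t p D g f) (ℓL κ Φ t p D g f) (hL κ Φ t p D g f) + kgΔY (kgR κ Φ t p D mk) (kgρ D)) / 2

/-- **The run length of record, second axis** `N := kgNY n_L ℓ_L h_L v_L R′ ρ q W tgt`. [this work] -/
def kgNYv (κ : Consts) {V : Type} [DecidableEq V] [Countable V] {G : SimpleGraph V} [G.LocallyFinite] (Φ : PlanarSkeletonFrmFrom G) (t : V) (p : unitInterval) (D : Skelφ.StepI.DataNS V) (g : ℕ) (f : ℕ) (mk : ℕ) (qx : ℕ) (Wx : ℕ) : ℕ :=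
  kgNY (nL κ Φ t p D g f) (ℓL κ Φ t p D g f) (hL κ Φ t p D g f) (vL κ Φ t p D g f) (kgR κ Φ t p D mk) (kgρ D) (kgqY κ Φ t p D g f qx)
    (kgWY κ Φ t p D g f Wx) (kgTgtY κ Φ t p D g f mk)

export PlanarSkeletonFrm.NegB (kgSLY_eq_kgSL)

end InputsY

/-! ## §2 The rows `KGYRows` at the values -/

section RowsY

variable (κ : Consts) {V : Type} [DecidableEq V] [Countable V] {G : SimpleGraph V} [G.LocallyFinite] (Φ : PlanarSkeletonFrmFrom G) (t : V) (p : unitInterval)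
  (D : Skelφ.StepI.DataNS V) (g f : ℕ)

/-- **THE ROWS AT THE VALUES, SECOND AXIS.** [this work] -/
theorem kgYRows_of (κ : Consts) {V : Type} [DecidableEq V] [Countable V] {G : SimpleGraph V} [G.LocallyFinite] (Φ : PlanarSkeletonFrmFrom G) (t : V) (p : unitInterval) (D : Skelφ.StepI.DataNS V) (g : ℕ) (f : ℕ) (mk qx Wx : ℕ) (hN : EqNumL κ Φ t p D g f) (hg : gFloorKG κ Φ t p D mk ≤ g)
    (hρv : ((Mu D : ℕ) : ℤ) + 1 + |vL κ Φ t p D g f| ≤ nL κ Φ t p D g f) :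
    KGYRows (nL κ Φ t p D g f) (ℓL κ Φ t p D g f) (hL κ Φ t p D g f) (vL κ Φ t p D g f) (kgR κ Φ t p D mk) (kgρ D) (kgqY κ Φ t p D g f qx)
      (kgWY κ Φ t p D g f Wx) := by
  have H := kgRows_of κ Φ t p D g f mk qx Wx hN hg hρv
  have hnle := hN.n_le
  have hgML : g ≤ ML κ Φ t p D g := (ML_le_ML κ Φ t p D g).2
  have hsL := ML_sub_one_le_kgSL κ Φ t p D g f hN
  unfold gFloorKG at hg
  refine ⟨H.hn, H.hv, H.hlay, ?_, H.hR₂, H.hρv, H.hρL, ?_, ?_⟩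
  · -- hR₁ : 6R′ + 3ρ + 2 ≤ sL
    rw [kgSLY_eq_kgSL]
    unfold kgR kgρ
    have : ((8 * KS0.R'0 κ Φ t p D mk + 3 * Mu D + 6 : ℕ) : ℤ) ≤ ML κ Φ t p D g := by exact_mod_cast hg.trans hgML
    push_cast at this ⊢
    linarith
  · -- hq : P ≤ q
    unfold kgqY; omega
  · -- hW : 3n ≤ 2W
    unfold kgWY; omega

/-- NON-VACUITY WITNESS of the second-axis row set (lead (g11) 2026-08-23T03:52:56Z standing order): `KGYRows` holds at the sample
`(n, ℓ, hs, v, R′, ρ, q, W) := (40, 60, 3, 5, 2, 3, 60, 60)` (`sL = 54`, `P = 56`). [folklore] -/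
example : KGYRows 40 60 3 5 2 3 60 60 := by constructor <;> decide

end RowsY

/-! ## §3 The run length's division bound -/

section RunLengthY

variable (κ : Consts) {V : Type} [DecidableEq V] [Countable V] {G : SimpleGraph V} [G.LocallyFinite] (Φ : PlanarSkeletonFrmFrom G) (t : V) (p : unitInterval)
  (D : Skelφ.StepI.DataNS V) (g f mk qx Wx : ℕ)

/-- `kgNYv ≤ ⌊tgt⌋₊ / ⌊sL⌋₊`. [folklore] -/
theorem kgNYv_le_div (κ : Consts) {V : Type} [DecidableEq V] [Countable V] {G : SimpleGraph V} [G.LocallyFinite] (Φ : PlanarSkeletonFrmFrom G) (t : V) (p : unitInterval) (D : Skelφ.StepI.DataNS V) (g : ℕ) (f : ℕ) (mk : ℕ) (qx : ℕ) (Wx : ℕ) : kgNYv κ Φ t p D g f mk qx Wx ≤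
    (kgTgtY κ Φ t p D g f mk).toNat / (kgSLY (nL κ Φ t p D g f) (ℓL κ Φ t p D g f) (hL κ Φ t p D g f)).toNat :=
  Nat.findGreatest_le _

end RunLengthY

end NegB

end PlanarSkeletonFrmFrom

end Summit.CriticalPhenomena.PercolationContinuityZ3.Theorems.Transplant

end
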